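import Literature.Algebra.Homology.ExactCoupleLefschetz
import HarnessLib

/-!
# Morphisms of homology exact couples and the functoriality of the pages

Companion to `ExactCoupleEuler.lean` / `ExactCoupleLefschetz.lean` (the tree's unrolled homology exact couples
`HomologyExactCouple K` over a division ring, with cycles `Zr`, boundaries `Br`, pages
`page ρ s q = Zr/Br = E^{ρ+1}`, differentials `dZ`, limit `Zinf/Binf` and abutment `einfEquiv`;
E. H. Spanier, *Algebraic Topology* (1981), Ch. 9, Sec. 1). A **morphism of exact couples**
(W. S. Massey, *Exact couples in algebraic topology*, Ann. of Math. 56 (1952), §4; Spanier, Ch. 9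
Sec. 1, before Thm. 3: "a homomorphism of exact couples … induces a homomorphism of the associated
spectral sequences") is a family of linear maps on the terms `A`, `E`, `H` commuting with `ι`, `j`,
`δ` and the abutment maps `φ`. This file PROVES that such a morphism maps `Im`, `Kr`, `Zr`, `Br`,
`Zinf`, `Kinf`, `Binf` and the abutment filtration `F` into the corresponding objects of the
target, hence induces maps of the pages `E^{ρ+1}` (`Hom.pageMap`) commuting with the
differentials `d^{ρ+1}` (`Hom.pageMap_dZ`) and of the limit terms (`Hom.einfMap`), with explicit
kernel and range (`subQuotMap_injective_iff`, `mem_range_subQuotMap_iff`, `Hom.injective_pageMap_iff`) — the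
functoriality needed to define the direct filtrations `F_d = Im (E_r(F^p K, W) → E_r(K, W))` of
Deligne's two-filtrations lemma (P. Deligne, *Théorie de Hodge II* (1971), 1.3.13–1.3.16;
*Théorie de Hodge III* (1974), 7.2; E. Cattani, F. El Zein, P. Griffiths, Lê D. T., *Hodge Theory*
(2014), Def. 3.2.26–Thm. 3.2.30, PDF pp. 165–167). Everything is proved; no named fact.

* complements on the tree's `subQuotMap` (`ExactCoupleLefschetz.lean`): `subQuotMap_mk_eq_zero_iff`,
  `subQuotMap_injective_iff`, `mem_range_subQuotMap_iff`.
* `HomologyExactCouple.Hom C C'` (structure), `Hom.id`, `Hom.comp`;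
  `Hom.map_Im_le`, `map_Kr_le`, `map_Zr_le`, `map_Br_le`, `map_Zinf_le`, `map_Kinf_le`,
  `map_Binf_le`, `map_F_le`, `map_Fp_le`;
  `Hom.pageMap` with `pageMap_mk`, `pageMap_dZ` (naturality of `d^{ρ+1}`), `injective_pageMap_iff`,
  `range_pageMap`; `Hom.einfMap`.

## References

* [Massey1952] W. S. Massey, Exact couples in algebraic topology I–II, Ann. of Math. 56 (1952), §4.
* [Spanier1981] E. H. Spanier, Algebraic Topology, Springer (1981), Ch. 9, Sec. 1.
* [DeligneHodgeII1971] P. Deligne, Théorie de Hodge II, Publ. Math. IHÉS 40 (1971), 1.3.13–1.3.16.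
* [CattaniElZeinGriffithsLe2014] Hodge Theory, Princeton Math. Notes 49 (2014), Def. 3.2.26–Thm. 3.2.30.
-/

noncomputable section

open Module

namespace Literature.Algebra.Homology

universe u v w

variable {K : Type u} [DivisionRing K]

/-! ### Maps of sub-quotients -/

section SubQuotMap

variable {V : Type v} [AddCommGroup V] [Module K V] {W : Type w} [AddCommGroup W] [Module K W]

/-- `subQuotMap f [z] = 0` iff `f z ∈ B'`. [folklore] -/
theorem subQuotMap_mk_eq_zero_iff (f : V →ₗ[K] W) (Z B : Submodule K V) (Z' B' : Submodule K W)
    (hZ : ∀ z ∈ Z, f z ∈ Z') (hB : ∀ b ∈ B, f b ∈ B') (z : Z) :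
    subQuotMap f Z B Z' B' hZ hB (Submodule.Quotient.mk z) = 0 ↔ f z ∈ B' := by
  rw [subQuotMap_mk, subQuot_mk_eq_zero_iff]

/-- **Injectivity criterion**: `Z/(B ∩ Z) → Z'/(B' ∩ Z')` is one-to-one iff
`f⁻¹(B') ∩ Z ⊆ B`. [folklore] -/
theorem subQuotMap_injective_iff (f : V →ₗ[K] W) (Z B : Submodule K V) (Z' B' : Submodule K W)
    (hZ : ∀ z ∈ Z, f z ∈ Z') (hB : ∀ b ∈ B, f b ∈ B') :
    Function.Injective (subQuotMap f Z B Z' B' hZ hB) ↔ ∀ z ∈ Z, f z ∈ B' → z ∈ B := by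
  rw [← LinearMap.ker_eq_bot, Submodule.eq_bot_iff]
  constructor
  · intro h z hz hfz
    have h0 := h (Submodule.Quotient.mk ⟨z, hz⟩)
      (by rw [LinearMap.mem_ker, subQuotMap_mk_eq_zero_iff]; exact hfz)
    exact (subQuot_mk_eq_zero_iff (⟨z, hz⟩ : Z)).1 h0
  · intro h x hx
    obtain ⟨z, rfl⟩ := Submodule.Quotient.mk_surjective _ x
    rw [LinearMap.mem_ker, subQuotMap_mk_eq_zero_iff] at hx
    exact (subQuot_mk_eq_zero_iff z).2 (h z z.2 hx)

/-- **The range** of `Z/(B ∩ Z) → Z'/(B' ∩ Z')` consists of the classes of the elements of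
`f(Z)`. [folklore] -/
theorem mem_range_subQuotMap_iff (f : V →ₗ[K] W) (Z B : Submodule K V) (Z' B' : Submodule K W)
    (hZ : ∀ z ∈ Z, f z ∈ Z') (hB : ∀ b ∈ B, f b ∈ B') (z' : Z') :
    Submodule.Quotient.mk z' ∈ LinearMap.range (subQuotMap f Z B Z' B' hZ hB) ↔
      ∃ z ∈ Z, f z - z' ∈ B' := by
  constructor
  · rintro ⟨x, hx⟩
    obtain ⟨z, rfl⟩ := Submodule.Quotient.mk_surjective _ x
    rw [subQuotMap_mk, Submodule.Quotient.eq] at hx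
    exact ⟨z, z.2, hx⟩
  · rintro ⟨z, hz, hzz'⟩
    exact ⟨Submodule.Quotient.mk ⟨z, hz⟩, by rw [subQuotMap_mk, Submodule.Quotient.eq]; exact hzz'⟩

end SubQuotMap

/-! ### Morphisms of homology exact couples -/

namespace HomologyExactCouple

/-- **A morphism of (unrolled homology) exact couples with abutment**: linear maps on the terms
`A s q`, `E s q`, `H q` commuting with `ι`, `j`, `δ` and the abutment maps `φ` (Massey 1952, §4;
Spanier 1981, Ch. 9 Sec. 1: "a homomorphism of exact couples"). The motivating instance is the
map of weight spectral sequences induced by a morphism of filtered complexes, e.g. the inclusion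
`(F^p K, W) → (K, W)` of Deligne's two-filtrations lemma. [cite: Massey1952, §4]
[cite: Spanier1981, Ch. 9 Sec. 1] -/
structure Hom (C C' : HomologyExactCouple.{u, v} K) where
  /-- the maps on `A s q` -/
  fA (s q : ℕ) : C.A s q →ₗ[K] C'.A s q
  /-- the maps on `E s q` -/
  fE (s q : ℕ) : C.E s q →ₗ[K] C'.E s q
  /-- the maps on the abutment `H q` -/
  fH (q : ℕ) : C.H q →ₗ[K] C'.H q
  /-- compatibility with `ι` -/
  comm_ι (q s s' : ℕ) (h : s ≤ s') (a : C.A s q) : fA s' q (C.ι q s s' h a) = C'.ι q s s' h (fA s q a)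
  /-- compatibility with `j` -/
  comm_j (s q : ℕ) (a : C.A s q) : fE s q (C.j s q a) = C'.j s q (fA s q a)
  /-- compatibility with `δ` -/
  comm_δ (s q : ℕ) (x : C.E (s + 1) (q + 1)) : fA s q (C.δ s q x) = C'.δ s q (fE (s + 1) (q + 1) x)
  /-- compatibility with the abutment maps `φ` -/
  comm_φ (s q : ℕ) (a : C.A s q) : fH q (C.φ s q a) = C'.φ s q (fA s q a)

namespace Hom

variable {C C' C'' : HomologyExactCouple.{u, v} K}

/-- The identity morphism. [folklore] -/
protected def id (C : HomologyExactCouple.{u, v} K) : Hom C C where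
  fA _ _ := LinearMap.id
  fE _ _ := LinearMap.id
  fH _ := LinearMap.id
  comm_ι _ _ _ _ _ := rfl
  comm_j _ _ _ := rfl
  comm_δ _ _ _ := rfl
  comm_φ _ _ _ := rfl

/-- Composition of morphisms. [folklore] -/
protected def comp (Ψ : Hom C' C'') (Φ : Hom C C') : Hom C C'' where
  fA s q := Ψ.fA s q ∘ₗ Φ.fA s q
  fE s q := Ψ.fE s q ∘ₗ Φ.fE s q
  fH q := Ψ.fH q ∘ₗ Φ.fH q
  comm_ι q s s' h a := by simp only [LinearMap.comp_apply, Φ.comm_ι, Ψ.comm_ι]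
  comm_j s q a := by simp only [LinearMap.comp_apply, Φ.comm_j, Ψ.comm_j]
  comm_δ s q x := by simp only [LinearMap.comp_apply, Φ.comm_δ, Ψ.comm_δ]
  comm_φ s q a := by simp only [LinearMap.comp_apply, Φ.comm_φ, Ψ.comm_φ]

variable (Φ : Hom C C')

/-! #### Images, kernels, cycles and boundaries are preserved -/

/-- `Φ(ι^ρ H_q(X_{s-ρ})) ⊆ ι^ρ H'_q(X'_{s-ρ})`. [folklore] -/
theorem map_Im_le (ρ s q : ℕ) : (C.Im ρ s q).map (Φ.fA s q) ≤ C'.Im ρ s q := by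
  unfold Im
  by_cases h : ρ ≤ s
  · rw [if_pos h, if_pos h]
    rintro _ ⟨_, ⟨a, rfl⟩, rfl⟩
    rw [Φ.comm_ι]
    exact LinearMap.mem_range_self _ _
  · rw [if_neg h, if_neg h, Submodule.map_bot]

/-- `Φ(ker ι^ρ) ⊆ ker ι'^ρ`. [folklore] -/
theorem map_Kr_le (ρ t q : ℕ) : (C.Kr ρ t q).map (Φ.fA t q) ≤ C'.Kr ρ t q := by
  rintro _ ⟨a, ha, rfl⟩
  change C'.ι q t (t + ρ) _ (Φ.fA t q a) = 0
  rw [← Φ.comm_ι, show C.ι q t (t + ρ) _ a = 0 from ha, map_zero]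

/-- **`Φ(Z^{ρ+1}) ⊆ Z'^{ρ+1}`**. [cite: Spanier1981, Ch. 9 Sec. 1] -/
theorem map_Zr_le (ρ s q : ℕ) : (C.Zr ρ s q).map (Φ.fE s q) ≤ C'.Zr ρ s q := by
  cases s with
  | zero => rw [C'.Zr_zero_left]; exact le_top
  | succ s =>
    cases q with
    | zero => exact le_top
    | succ q =>
      rintro _ ⟨x, hx, rfl⟩
      have hx' : C.δ s q x ∈ C.Im ρ s q := hx
      change C'.δ s q (Φ.fE (s + 1) (q + 1) x) ∈ C'.Im ρ s q
      rw [← Φ.comm_δ]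
      exact Φ.map_Im_le ρ s q ⟨_, hx', rfl⟩

/-- **`Φ(B^{ρ+1}) ⊆ B'^{ρ+1}`**. [cite: Spanier1981, Ch. 9 Sec. 1] -/
theorem map_Br_le (ρ s q : ℕ) : (C.Br ρ s q).map (Φ.fE s q) ≤ C'.Br ρ s q := by
  rintro _ ⟨_, ⟨a, ha, rfl⟩, rfl⟩
  rw [Φ.comm_j]
  exact Submodule.mem_map_of_mem (Φ.map_Kr_le ρ s q ⟨a, ha, rfl⟩)

/-- `Φ(Z^∞) ⊆ Z'^∞`. [folklore] -/
theorem map_Zinf_le (s q : ℕ) : (C.Zinf s q).map (Φ.fE s q) ≤ C'.Zinf s q := by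
  rw [← range_j_eq_Zinf, ← range_j_eq_Zinf]
  rintro _ ⟨_, ⟨a, rfl⟩, rfl⟩
  rw [Φ.comm_j]
  exact LinearMap.mem_range_self _ _

/-- `Φ(ker φ) ⊆ ker φ'`. [folklore] -/
theorem map_Kinf_le (s q : ℕ) : (C.Kinf s q).map (Φ.fA s q) ≤ C'.Kinf s q := by
  rintro _ ⟨a, ha, rfl⟩
  change C'.φ s q (Φ.fA s q a) = 0
  rw [← Φ.comm_φ, show C.φ s q a = 0 from ha, map_zero]

/-- `Φ(B^∞) ⊆ B'^∞`. [folklore] -/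
theorem map_Binf_le (s q : ℕ) : (C.Binf s q).map (Φ.fE s q) ≤ C'.Binf s q := by
  rintro _ ⟨_, ⟨a, ha, rfl⟩, rfl⟩
  rw [Φ.comm_j]
  exact Submodule.mem_map_of_mem (Φ.map_Kinf_le s q ⟨a, ha, rfl⟩)

/-- `Φ(F_s H) ⊆ F_s H'` for the filtrations of the abutments. [folklore] -/
theorem map_F_le (s q : ℕ) : (C.F s q).map (Φ.fH q) ≤ C'.F s q := by
  rintro _ ⟨_, ⟨a, rfl⟩, rfl⟩
  rw [Φ.comm_φ]
  exact LinearMap.mem_range_self _ _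

/-- `Φ(F_{s-1} H) ⊆ F_{s-1} H'`. [folklore] -/
theorem map_Fp_le (s q : ℕ) : (C.Fp s q).map (Φ.fH q) ≤ C'.Fp s q := by
  cases s with
  | zero => change (⊥ : Submodule K (C.H q)).map _ ≤ ⊥; rw [Submodule.map_bot]
  | succ s => exact Φ.map_F_le s q

/-! #### The induced maps of the pages and their naturality -/

/-- **The map of pages `E^{ρ+1}(C) → E^{ρ+1}(C')` induced by a morphism of exact couples**
(Spanier 1981, Ch. 9 Sec. 1: "induces a homomorphism of the associated spectral sequences").
[cite: Spanier1981, Ch. 9 Sec. 1] [cite: Massey1952, §4] -/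
def pageMap (ρ s q : ℕ) : C.page ρ s q →ₗ[K] C'.page ρ s q :=
  subQuotMap (Φ.fE s q) (C.Zr ρ s q) (C.Br ρ s q) (C'.Zr ρ s q) (C'.Br ρ s q)
    (fun z hz ↦ Φ.map_Zr_le ρ s q ⟨z, hz, rfl⟩) (fun b hb ↦ Φ.map_Br_le ρ s q ⟨b, hb, rfl⟩)

/-- `pageMap [z] = [Φ z]`. [folklore] -/
@[simp]
theorem pageMap_mk (ρ s q : ℕ) (z : C.Zr ρ s q) :
    Φ.pageMap ρ s q (Submodule.Quotient.mk z) =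
      Submodule.Quotient.mk ⟨Φ.fE s q z, Φ.map_Zr_le ρ s q ⟨z, z.2, rfl⟩⟩ := rfl

/-- **Naturality of the differentials**: `pageMap (d^{ρ+1} z) = d'^{ρ+1} (Φ z)` for
`z ∈ Z^{ρ+1}` (`d[z] = [j a]` for any `a` with `ι^ρ a = δ z`, and `Φ` commutes with `ι`, `j`,
`δ`). [cite: Spanier1981, Ch. 9 Sec. 1] [cite: Massey1952, §4] -/
theorem pageMap_dZ (ρ t q : ℕ) (z : C.Zr ρ (t + ρ + 1) (q + 1)) :
    Φ.pageMap ρ t q (C.dZ ρ t q z) =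
      C'.dZ ρ t q ⟨Φ.fE (t + ρ + 1) (q + 1) z, Φ.map_Zr_le ρ _ _ ⟨z, z.2, rfl⟩⟩ := by
  obtain ⟨a, ha⟩ := C.δ_mem_range_of_mem_Zr ρ t q z.2
  have ha' : C'.ι q t (t + ρ) (Nat.le_add_right t ρ) (Φ.fA t q a) =
      C'.δ (t + ρ) q (Φ.fE (t + ρ + 1) (q + 1) z) := by
    rw [← Φ.comm_ι, ha, Φ.comm_δ]
  rw [C.dZ_apply_of_eq ρ t q z a ha, C'.dZ_apply_of_eq ρ t q _ (Φ.fA t q a) ha', pageMap_mk]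
  congr 1
  exact Subtype.ext (Φ.comm_j t q a)

/-- **Injectivity of the page map**: `E^{ρ+1}(C) → E^{ρ+1}(C')` is one-to-one iff every cycle
of `C` whose image is a boundary of `C'` is a boundary of `C` (`Φ⁻¹(B') ∩ Z ⊆ B`) — the form in
which Deligne's two-filtrations lemma asserts `E_r(F^p K, W) ↪ E_r(K, W)`.
[cite: DeligneHodgeII1971, 1.3.16] -/
theorem injective_pageMap_iff (ρ s q : ℕ) :
    Function.Injective (Φ.pageMap ρ s q) ↔
      ∀ z ∈ C.Zr ρ s q, Φ.fE s q z ∈ C'.Br ρ s q → z ∈ C.Br ρ s q :=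
  subQuotMap_injective_iff _ _ _ _ _ _ _

/-- **The range of the page map** (the "direct filtration" `F_d = Im(E_r(F^pK) → E_r(K))` of
Deligne's two-filtrations lemma is of this form): the classes `[z']`, `z' ∈ Z'`, congruent modulo
`B'` to some `Φ z`, `z ∈ Z`. [cite: DeligneHodgeII1971, 1.3.13] [cite: CattaniElZeinGriffithsLe2014, Def. 3.2.26] -/
theorem mk_mem_range_pageMap_iff (ρ s q : ℕ) (z' : C'.Zr ρ s q) :
    Submodule.Quotient.mk z' ∈ LinearMap.range (Φ.pageMap ρ s q) ↔
      ∃ z ∈ C.Zr ρ s q, Φ.fE s q z - z' ∈ C'.Br ρ s q :=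
  mem_range_subQuotMap_iff _ _ _ _ _ _ _ z'

/-- The map of limit terms `E^∞(C) → E^∞(C')`. [cite: Spanier1981, Ch. 9 Sec. 1] -/
def einfMap (s q : ℕ) : SubQuot (C.Zinf s q) (C.Binf s q) →ₗ[K] SubQuot (C'.Zinf s q) (C'.Binf s q) :=
  subQuotMap (Φ.fE s q) _ _ _ _ (fun z hz ↦ Φ.map_Zinf_le s q ⟨z, hz, rfl⟩)
    (fun b hb ↦ Φ.map_Binf_le s q ⟨b, hb, rfl⟩)

/-- `einfMap [z] = [Φ z]`. [folklore] -/
@[simp]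
theorem einfMap_mk (s q : ℕ) (z : C.Zinf s q) :
    Φ.einfMap s q (Submodule.Quotient.mk z) =
      Submodule.Quotient.mk ⟨Φ.fE s q z, Φ.map_Zinf_le s q ⟨z, z.2, rfl⟩⟩ := rfl

/-- The map of graded pieces of the abutments `F_s H / F_{s-1} H → F_s H' / F_{s-1} H'`. [folklore] -/
def grMap (s q : ℕ) : SubQuot (C.F s q) (C.Fp s q) →ₗ[K] SubQuot (C'.F s q) (C'.Fp s q) :=
  subQuotMap (Φ.fH q) _ _ _ _ (fun z hz ↦ Φ.map_F_le s q ⟨z, hz, rfl⟩)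
    (fun b hb ↦ Φ.map_Fp_le s q ⟨b, hb, rfl⟩)

/-- `grMap [h] = [Φ h]`. [folklore] -/
@[simp]
theorem grMap_mk (s q : ℕ) (z : C.F s q) :
    Φ.grMap s q (Submodule.Quotient.mk z) =
      Submodule.Quotient.mk ⟨Φ.fH q z, Φ.map_F_le s q ⟨z, z.2, rfl⟩⟩ := rfl

end Hom

end HomologyExactCouple

end Literature.Algebra.Homology

end
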